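import Summits.AtomisticToContinuum.Crystallization.Theorems.FrustratedLawDichotomyTwoShellRigidityGaugedLadder

/-!
# PART B of lens-5 g32 `TwoShellRigidityGaugedLadder.lean` (sha256 7a91fe068329bbfb…; module docstring of record in PART A)

§3 ★ relaxation validity `gRungAt_of_rungLP : RungLP ⟹ GRungAt`.
(Split A → B → C → D for the 400-line rule by prover hand 1, gen 11, --supports stmt-AtomisticToContinuum-27623; declarations byte-identical; gate-forced delta: docstrings on undocumented helper lemmas.)
-/

noncomputable section

namespace Summit.AtomisticToContinuum.Crystallization.Theorems.FrustratedLawDichotomyTwoShellRigidityGaugedLadder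


open Literature.Geometry.DiscreteGeometry
open Summit.AtomisticToContinuum.Crystallization.Theorems.FrustratedLawDichotomyTwoShellRigidityCut
open Summit.AtomisticToContinuum.Crystallization.Theorems.FrustratedLawDichotomyTwoShellRigidityCells
open Summit.AtomisticToContinuum.Crystallization.Theorems.FrustratedLawDichotomyBondGraphWindows
open Summit.AtomisticToContinuum.Crystallization.Theorems.FrustratedLawDichotomyTwoShellRigidityLadder (CapAprioriAt)
open Summit.AtomisticToContinuum.Crystallization.Theorems.FrustratedLawDichotomyTwoShellRigidityLadderCap
  (capAprioriAt_fcc capAprioriAt_hcp capAprioriAt_trilateration_fcc capAprioriAt_trilateration_hcp)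
open Summit.AtomisticToContinuum.Crystallization.Theorems.FrustratedLawDichotomyTwoShellRigidityProbeCovering (covers_probes26)
open scoped RealInnerProductSpace

/-! ## 3. ★ Relaxation validity: `RungLP ⟹ GRung` -/

/-- Elementary: the window rows from the two length bounds of a bond with unit reference. [folklore] -/
theorem rows_of_bounds {θ s : ℝ} {e δ : E3} (he : ‖e‖ = 1) (hs : 0 ≤ s) (hlo : s ≤ ‖e + δ‖) (hhi : ‖e + δ‖ ≤ (1 + θ) * s) :
    Rows θ s (bondSq e δ) := by
  have hE : ‖e + δ‖ ^ 2 = bondSq e δ := by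
    rw [bondSq, norm_add_sq_real, he]; ring
  refine ⟨?_, ?_⟩
  · rw [← hE]; exact pow_le_pow_left₀ hs hlo 2
  · have h := pow_le_pow_left₀ (norm_nonneg _) hhi 2
    rw [hE] at h
    calc bondSq e δ ≤ ((1 + θ) * s) ^ 2 := h
      _ = (1 + θ) ^ 2 * s ^ 2 := by ring

/-- Elementary: the scale box from the two ratio bounds. [folklore] -/
theorem scaleBox_of_bounds {κ s : ℝ} (hκ : 0 < κ) (hlo : 1 ≤ κ * s) (hhi : s ≤ κ) : ScaleBox κ s := by
  refine ⟨hlo, hhi, ?_⟩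
  have hge : κ⁻¹ ≤ s := by
    rw [inv_le_iff_one_le_mul₀ hκ]; linarith [mul_comm κ s]
  have hprod : (s - κ⁻¹) * (s - κ) ≤ 0 :=
    mul_nonpos_iff.2 (Or.inl ⟨sub_nonneg.2 hge, sub_nonpos.2 hhi⟩)
  have hk : κ⁻¹ * κ = 1 := inv_mul_cancel₀ hκ.ne'
  have hid : s ^ 2 - ((κ⁻¹ + κ) * s - 1) = (s - κ⁻¹) * (s - κ) + (1 - κ⁻¹ * κ) := by ring
  rw [hk, sub_self, add_zero] at hid
  linarith [hid]

/-- Elementary: a one-sided directional bound family plus the covering constant bound the squared norm. [folklore] -/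
theorem sq_norm_le_of_covers {D : List E3} {ρ b : ℝ} (hρ : 0 ≤ ρ) (hcov : Covers D ρ) {v : E3} (hv : ∀ n ∈ D, ⟪n, v⟫ ≤ b) :
    ‖v‖ ^ 2 ≤ (ρ * b) ^ 2 := by
  obtain ⟨n, hn, hle⟩ := hcov v
  have h : ‖v‖ ≤ ρ * b := hle.trans (mul_le_mul_of_nonneg_left (hv n hn) hρ)
  exact pow_le_pow_left₀ (norm_nonneg _) h 2

/-- `‖v‖ ≤ ρ·b` from the covering constant and the directional bounds `⟪n, v⟫ ≤ b` (`n ∈ D`). [folklore] -/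
theorem norm_le_of_covers {D : List E3} {ρ b : ℝ} (hρ : 0 ≤ ρ) (hcov : Covers D ρ) {v : E3} (hv : ∀ n ∈ D, ⟪n, v⟫ ≤ b) :
    ‖v‖ ≤ ρ * b := by
  obtain ⟨n, hn, hle⟩ := hcov v
  exact hle.trans (mul_le_mul_of_nonneg_left (hv n hn) hρ)

/-- Pattern geometry: for a square `(u, v)` (`dist u v = √2`) of a pattern of unit vectors and a vertex `w` of it, the cap-bond reference
`u + v − w` is a unit vector. [folklore] -/
theorem norm_capRef_eq_one {Pat : Finset E3} (h1 : ∀ z ∈ Pat, ‖z‖ = 1) {u v w : ↥Pat}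
    (huv : dist (u : E3) (v : E3) = Real.sqrt 2) (hw : SqVert u v w) : ‖(u : E3) + v - w‖ = 1 := by
  have hu := h1 u u.2
  have hv := h1 v v.2
  have hw1 := h1 w w.2
  rcases hw with rfl | rfl | ⟨hwu, hwv⟩
  · simpa using hv
  · simpa using hu
  · have h2 : (0 : ℝ) ≤ 2 := by norm_num
    have huv' : ‖(u : E3) - v‖ ^ 2 = 2 := by
      rw [← dist_eq_norm, huv, Real.sq_sqrt h2]
    have hwu' : ‖(w : E3) - u‖ ^ 2 = 1 := by rw [← dist_eq_norm, hwu]; norm_num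
    have hwv' : ‖(w : E3) - v‖ ^ 2 = 1 := by rw [← dist_eq_norm, hwv]; norm_num
    rw [norm_sub_sq_real] at huv' hwu' hwv'
    have hsq : ‖(u : E3) + v - w‖ ^ 2 = 1 := by
      rw [norm_sub_sq_real, norm_add_sq_real, inner_add_left, hu, hv, hw1]
      rw [hu, hv] at huv'
      rw [hw1, hu, real_inner_comm] at hwu'
      rw [hw1, hv, real_inner_comm] at hwv'
      linarith
    exact (pow_eq_one_iff_of_nonneg (norm_nonneg _) two_ne_zero).1 hsq

/-- The normalised, frame-read positions: `z + resAt y i A j z = A⁻¹((y j − y i)/nn_i)`, so bond vectors are read off exactly: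
`‖(zj − zk) + (res_j − res_k)‖ = dist(y j, y k)/nn_i`. [folklore] -/
theorem norm_ref_add_res_sub {N : ℕ} (y : Fin N → E3) (i : Fin N) (A : E3 ≃ₗᵢ[ℝ] E3) (hr : 0 < nearestDist y i)
    (j k : Fin N) (zj zk : E3) :
    ‖(zj - zk) + (resAt y i A j zj - resAt y i A k zk)‖ = (nearestDist y i)⁻¹ * dist (y j) (y k) := by
  have h2 : A.symm ((nearestDist y i)⁻¹ • (y j - y k)) =
      A.symm ((nearestDist y i)⁻¹ • (y j - y i)) - A.symm ((nearestDist y i)⁻¹ • (y k - y i)) := by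
    rw [← map_sub, ← smul_sub, sub_sub_sub_cancel_right]
  have h : (zj - zk) + (resAt y i A j zj - resAt y i A k zk) = A.symm ((nearestDist y i)⁻¹ • (y j - y k)) := by
    simp only [resAt]
    rw [h2]
    abel
  rw [h, LinearIsometryEquiv.norm_map, norm_smul, Real.norm_of_nonneg (inv_nonneg.2 hr.le), dist_eq_norm]

/-- The radial identity `‖z + resAt y i A j z‖ = dist (y j) (y i) / nn_i`. [folklore] -/
theorem norm_ref_add_res {N : ℕ} (y : Fin N → E3) (i : Fin N) (A : E3 ≃ₗᵢ[ℝ] E3) (hr : 0 < nearestDist y i)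
    (j : Fin N) (z : E3) : ‖z + resAt y i A j z‖ = (nearestDist y i)⁻¹ * dist (y j) (y i) := by
  have h := norm_ref_add_res_sub y i A hr j i z 0
  have h0 : resAt y i A i 0 = 0 := by simp [resAt]
  simpa [h0] using h

/-- The two window rows of a `θ`-bond `j ∼ k` at BOTH endpoints, in units of `nn_i`, for any unit reference `e` with
`‖e + δ‖ = dist(y j, y k)/nn_i`. [folklore] -/
theorem rows_of_adj {θ : ℝ} {N : ℕ} {y : Fin N → E3} {i j k : Fin N} (hθ : 0 ≤ 1 + θ) (hr : 0 < nearestDist y i)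
    (hadj : (bondGraph θ y).Adj j k) {e δ : E3} (he : ‖e‖ = 1) (hE : ‖e + δ‖ = (nearestDist y i)⁻¹ * dist (y j) (y k)) :
    Rows θ (nearestDist y j / nearestDist y i) (bondSq e δ) ∧ Rows θ (nearestDist y k / nearestDist y i) (bondSq e δ) := by
  set r := nearestDist y i with hr_def
  have hri : 0 ≤ r⁻¹ := inv_nonneg.2 hr.le
  have hne : j ≠ k := hadj.ne
  have hjk : nearestDist y j ≤ dist (y j) (y k) := nearestDist_le_dist y hne.symm
  have hkj : nearestDist y k ≤ dist (y j) (y k) := by rw [dist_comm]; exact nearestDist_le_dist y hne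
  have hj : dist (y j) (y k) ≤ (1 + θ) * nearestDist y j := dist_le_of_adj hθ hadj
  have hk : dist (y j) (y k) ≤ (1 + θ) * nearestDist y k := by rw [dist_comm]; exact dist_le_of_adj hθ hadj.symm
  constructor
  · refine rows_of_bounds he (div_nonneg (nearestDist_nonneg _ _) hr.le) ?_ ?_
    · rw [hE, div_eq_inv_mul]; exact mul_le_mul_of_nonneg_left hjk hri
    · rw [hE, div_eq_inv_mul]
      calc r⁻¹ * dist (y j) (y k) ≤ r⁻¹ * ((1 + θ) * nearestDist y j) := mul_le_mul_of_nonneg_left hj hri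
        _ = (1 + θ) * (r⁻¹ * nearestDist y j) := by ring
  · refine rows_of_bounds he (div_nonneg (nearestDist_nonneg _ _) hr.le) ?_ ?_
    · rw [hE, div_eq_inv_mul]; exact mul_le_mul_of_nonneg_left hkj hri
    · rw [hE, div_eq_inv_mul]
      calc r⁻¹ * dist (y j) (y k) ≤ r⁻¹ * ((1 + θ) * nearestDist y k) := mul_le_mul_of_nonneg_left hk hri
        _ = (1 + θ) * (r⁻¹ * nearestDist y k) := by ring

/-- The scale box of a site reached from `i` by a path of `θ`-bonds: one bond gives the factor `1+θ`, two bonds `(1+θ)²`. [folklore] -/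
theorem scaleBox_of_adj {θ : ℝ} {N : ℕ} {y : Fin N → E3} {i j : Fin N} (hθ : 0 < 1 + θ) (hr : 0 < nearestDist y i)
    (hadj : (bondGraph θ y).Adj i j) : ScaleBox (1 + θ) (nearestDist y j / nearestDist y i) := by
  obtain ⟨h1, h2⟩ := nearestDist_le_mul_nearestDist_of_adj hθ.le hadj
  refine scaleBox_of_bounds hθ ?_ ?_
  · rw [mul_div_assoc', le_div_iff₀ hr, one_mul]; exact h1
  · rw [div_le_iff₀ hr]; exact h2

/-- Scale box of a second-shell site: `i ∼ j ∼ m ⟹ ScaleBox ((1+θ)²) (nn_m / nn_i)`. [folklore] -/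
theorem scaleBox_of_adj_adj {θ : ℝ} {N : ℕ} {y : Fin N → E3} {i j m : Fin N} (hθ : 0 < 1 + θ) (hr : 0 < nearestDist y i)
    (hij : (bondGraph θ y).Adj i j) (hjm : (bondGraph θ y).Adj j m) :
    ScaleBox ((1 + θ) ^ 2) (nearestDist y m / nearestDist y i) := by
  obtain ⟨h1, h2⟩ := nearestDist_le_mul_nearestDist_of_adj hθ.le hij
  obtain ⟨h3, h4⟩ := nearestDist_le_mul_nearestDist_of_adj hθ.le hjm
  refine scaleBox_of_bounds (pow_pos hθ 2) ?_ ?_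
  · rw [mul_div_assoc', le_div_iff₀ hr, one_mul]
    calc nearestDist y i ≤ (1 + θ) * nearestDist y j := h1
      _ ≤ (1 + θ) * ((1 + θ) * nearestDist y m) := mul_le_mul_of_nonneg_left h3 hθ.le
      _ = (1 + θ) ^ 2 * nearestDist y m := by ring
  · rw [div_le_iff₀ hr]
    calc nearestDist y m ≤ (1 + θ) * nearestDist y j := h4
      _ ≤ (1 + θ) * ((1 + θ) * nearestDist y i) := mul_le_mul_of_nonneg_left h2 hθ.le
      _ = (1 + θ) ^ 2 * nearestDist y i := by ring

/-- ★ **RELAXATION VALIDITY — `RungLP ⟹ GRung`.**  For a pattern of unit vectors, a probe set `Din` with covering constant `ρ ≥ 0` and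
`θ ≥ 0`: if the finite linear statement `RungLP(Pat, Din → Dout, Γ, θ, ρ, P → Q)` holds, then every gauged `Din`-fit of tolerance `P` of a
capped `Pat`-link in an injective configuration is — for the SAME isometry — a gauged `Dout`-fit of tolerance `Q`.
PROOF = the extraction: rescale by `nn_i`, read positions in the frame of `A` (an isometry: bond lengths are read off exactly,
`norm_ref_add_res_sub`), instantiate the finite statement with `s u = nn_{τu}/nn_i`, `t u v = nn_m/nn_i` for a cap assignment `m(u,v)` that
contains the cap under inspection, and discharge: scale boxes from `nn ≤ (1+θ)·nn'` along bonds; window rows from `nn_end ≤ length ≤ (1+θ)·nn_end`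
squared (`rows_of_adj`); slack from the covering constant.  [folklore bookkeeping; THIS is the lemma that makes every rung «table + linear
arithmetic» (critic row 452 (A)(a)).] -/
theorem gRungAt_of_rungLP {Pat : Finset E3} {Din Dout : List E3} {Γ : (↥Pat → E3) → Prop} {θ ρ : ℝ} {P Q : ℝ × ℝ × ℝ × ℝ}
    (h1 : ∀ z ∈ Pat, ‖z‖ = 1) (hθ : 0 ≤ θ) (hρ : 0 ≤ ρ) (hcov : Covers Din ρ)
    (hlp : RungLP Pat Din Dout Γ θ ρ P Q) : GRungAt Pat Din Dout Γ θ P Q := by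
  classical
  intro N y i τ hy _hsep hL hC A hfit
  obtain ⟨hf1, hf2, hf3, hf4, hΓ⟩ := hfit
  have hθ1 : 0 < 1 + θ := by linarith
  -- a valid cap assignment exists, and can be forced to contain any given cap
  have hcapex : ∀ u v : ↥Pat, dist (u : E3) (v : E3) = Real.sqrt 2 → ∃ m, IsCap θ y i τ u v m := by
    intro u v huv
    obtain ⟨m, hmi, hm⟩ := hC u v huv
    exact ⟨m, hmi, hm⟩
  -- the shell residual field and the scale ratios
  set x : ↥Pat → E3 := fun u => resAt y i A (τ u) u with hx_def
  -- ### the finite statement, for every valid cap assignment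
  have key : ∀ mc : ↥Pat → ↥Pat → Fin N, (∀ u v : ↥Pat, dist (u : E3) (v : E3) = Real.sqrt 2 → IsCap θ y i τ u v (mc u v)) →
      DirFit Dout Q x (fun u v => resAt y i A (mc u v) ((u : E3) + v)) := by
    intro mc hmc
    rcases isEmpty_or_nonempty ↥Pat with hE | ⟨⟨u₀⟩⟩
    · exact ⟨fun _ _ u => (hE.false u).elim, fun _ _ u => (hE.false u).elim, fun _ _ u => (hE.false u).elim,
        fun _ _ u => (hE.false u).elim⟩
    have hr : 0 < nearestDist y i := nearestDist_pos_of_adj hy (hL.1 u₀)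
    set r := nearestDist y i with hr_def
    set c : ↥Pat → ↥Pat → E3 := fun u v => resAt y i A (mc u v) ((u : E3) + v) with hc_def
    set s : ↥Pat → ℝ := fun u => nearestDist y (τ u) / r with hs_def
    set t : ↥Pat → ↥Pat → ℝ := fun u v => nearestDist y (mc u v) / r with ht_def
    have hsi : nearestDist y i / r = 1 := div_self hr.ne'
    refine hlp x c s t ⟨hf1, ?_, hf3, ?_⟩ hΓ ?_ ?_ ?_ ?_ ?_ ?_ ?_ ?_ ?_
    -- input fit, cap clauses
    · intro n hn u v huv
      exact hf2 n hn u v huv (mc u v) (hmc u v huv)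
    · intro n hn u v huv w hw
      exact hf4 n hn u v huv (mc u v) (hmc u v huv) w hw
    -- scale boxes
    · intro u
      exact scaleBox_of_adj hθ1 hr (hL.1 u)
    · intro u v huv
      obtain ⟨-, hbond⟩ := hmc u v huv
      have hmu : (bondGraph θ y).Adj (τ u) (mc u v) := (hbond u (Or.inl rfl)).symm
      exact scaleBox_of_adj_adj hθ1 hr (hL.1 u) hmu
    -- radial rows
    · intro u
      have hE : ‖(u : E3) + x u‖ = r⁻¹ * dist (y (τ u)) (y i) := norm_ref_add_res y i A hr (τ u) u
      have h := rows_of_adj (j := τ u) (k := i) hθ1.le hr (hL.1 u).symm (h1 u u.2) hE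
      rw [hsi] at h
      exact ⟨h.2, h.1⟩
    -- link rows
    · intro u w huw
      have hE : ‖((u : E3) - w) + (x u - x w)‖ = r⁻¹ * dist (y (τ u)) (y (τ w)) :=
        norm_ref_add_res_sub y i A hr (τ u) (τ w) u w
      have he : ‖(u : E3) - w‖ = 1 := by rw [← dist_eq_norm, huw]
      exact (rows_of_adj hθ1.le hr ((hL.2.2 u w).2 huw) he hE).1
    -- cap rows
    · intro u v huv w hw
      obtain ⟨-, hbond⟩ := hmc u v huv
      have hE : ‖((u : E3) + v - w) + (c u v - x w)‖ = r⁻¹ * dist (y (mc u v)) (y (τ w)) :=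
        norm_ref_add_res_sub y i A hr (mc u v) (τ w) ((u : E3) + v) w
      exact rows_of_adj hθ1.le hr (hbond w hw) (norm_capRef_eq_one h1 huv hw) hE
    -- slack
    · intro u
      exact sq_norm_le_of_covers hρ hcov fun n hn => hf1 n hn u
    · intro u v huv
      exact sq_norm_le_of_covers hρ hcov fun n hn => hf2 n hn u v huv (mc u v) (hmc u v huv)
    · intro u w huw
      exact sq_norm_le_of_covers hρ hcov fun n hn => hf3 n hn u w huw
    · intro u v huv w hw
      exact sq_norm_le_of_covers hρ hcov fun n hn => hf4 n hn u v huv (mc u v) (hmc u v huv) w hw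
  -- ### a default assignment, and the assignment forced through a given cap
  set mc₀ : ↥Pat → ↥Pat → Fin N := fun u v =>
    if h : dist (u : E3) (v : E3) = Real.sqrt 2 then Classical.choose (hcapex u v h) else i with hmc₀_def
  have hmc₀ : ∀ u v : ↥Pat, dist (u : E3) (v : E3) = Real.sqrt 2 → IsCap θ y i τ u v (mc₀ u v) := by
    intro u v h
    have : mc₀ u v = Classical.choose (hcapex u v h) := by simp [hmc₀_def, h]
    rw [this]
    exact Classical.choose_spec (hcapex u v h)
  have hforce : ∀ (u v : ↥Pat) (m : Fin N), dist (u : E3) (v : E3) = Real.sqrt 2 → IsCap θ y i τ u v m →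
      ∃ mc : ↥Pat → ↥Pat → Fin N, mc u v = m ∧
        ∀ a b : ↥Pat, dist (a : E3) (b : E3) = Real.sqrt 2 → IsCap θ y i τ a b (mc a b) := by
    intro u v m huv hm
    refine ⟨fun a b => if a = u ∧ b = v then m else mc₀ a b, by simp, ?_⟩
    intro a b hab
    by_cases h : a = u ∧ b = v
    · obtain ⟨rfl, rfl⟩ := h
      simpa using hm
    · simp only [h, if_false]
      exact hmc₀ a b hab
  -- ### conclusion
  obtain ⟨hq1, -, hq3, -⟩ := key mc₀ hmc₀
  refine ⟨hq1, ?_, hq3, ?_, hΓ⟩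
  · intro n hn u v huv m hm
    obtain ⟨mc, hmcuv, hmc⟩ := hforce u v m huv hm
    obtain ⟨-, hq2, -, -⟩ := key mc hmc
    have := hq2 n hn u v huv
    simpa only [hmcuv] using this
  · intro n hn u v huv m hm w hw
    obtain ⟨mc, hmcuv, hmc⟩ := hforce u v m huv hm
    obtain ⟨-, -, -, hq4⟩ := key mc hmc
    have := hq4 n hn u v huv w hw
    simpa only [hmcuv] using this

end Summit.AtomisticToContinuum.Crystallization.Theorems.FrustratedLawDichotomyTwoShellRigidityGaugedLadder
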